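import Literature.NumberTheory.QuadraticFields.SqrtNegTwoFieldPrimes
import Literature.NumberTheory.GaloisRepresentations.PrimaryGeneratorHeckeCharacter
import HarnessLib

/-!
# The Größencharakter `𝔭 = (π) ↦ σ(π)`, `π` primary, of `ℚ(√−2)` modulo `(4√−2)` — the ideal-theoretic Hecke character of the `j = 8000`
# curves (Rajwade 1968) — and its Frobenius matching `ψ(v) + ψ(c • v) = S(p)`, `ψ(v) ψ(c • v) = p`, `ψ(v) = −p`

Topic `Literature/NumberTheory/QuadraticFields`, namespace `Literature.NumberTheory.QuadraticFields.SqrtNegTwo`.  THEOREMS and one definition (`psi`);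
no instance, no notation, no named fact.  The `ℚ(√−2)` twin of `OmegaPrimeGrossencharakter` / `OmegaPrimeGrossencharakterDatum`, on
`SqrtNegTwoFieldPrimes` (`FieldData θ`: `[K : ℚ] = 2`, `θ² = −2`; `hK.ringEquiv : ℤ√(-2) ≃+* 𝓞 K`; `gen hK v`; the modulus `hK.modulus = (4√−2)`)
and `SqrtNegTwoPrimary` (Rajwade's primary associate `primary z`, the sums `S(m) = primarySum m = Σ_{x primary, N x = m} x`), feeding the tree's
dictionary «Größencharakter `mod 𝔣` of type `(p, q)` ⇒ algebraic Hecke character» (`IsGrossencharakter`, `heckeOfGross`; Neukirch VII (6.14)).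

* §1 ★ `psi hK e v = e(primary (gen v))`, independent of the generator, `≠ 0` off `(√−2)`, `0` on it; ★ `idealPow_gen_span` (generic),
  `idealPow_psi_span : ψ̃((b)) = e(primary b)`; ★ `psi_smul_eq_conj : ψ(c • 𝔭) = conj ψ(𝔭)`;
* §2 ★★ `isGrossencharakter_psi : IsGrossencharakter (4√−2) (embType e) (embTypeConj e) ψ` (for `b ≡ c (mod 4√−2)` the same sign makes both
  primary: `ψ̃((b)) c = ψ̃((c)) b`) and the literal type-`(1,0)` form `isGrossencharakter_psi_one_zero`; `modulus_le_iff_two_mem`;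
* §3 ★★ Frobenius matching (Rajwade's Thm. 1 / Silverman II Ex. 2.30 on the character side): for a prime `p ≠ 2` and `v ∣ p`: `(4√−2) ∤ 𝔭_v`;
  split (`c • v ≠ v`) `ψ(v) + ψ(c • v) = e(S(p))`, `ψ(v) ψ(c • v) = p`; inert (`c • v = v`) `S(p) = 0`, `ψ(v) = −p` (`frobenius`,
  `frobenius_of_eq_primarySum`); packaged `exists_isGrossencharakter_datum`, and the algebraic Hecke character `exists_heckeCharacter_of_eq_primarySum`
  (infinity type `(1, 0)`, unramified at `v ∣ p ≠ 2`, `ψ(ϖ_{c•v}) = conj ψ(ϖ_v)`, Deuring's values against `f p = S(p)`).  With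
  `a_m(B₋₁) = S(m)` for `B₋₁ : y² = x³ − 4x² + 2x` (`SqrtTwoTwist.lFunction_eq_jacobiSym_mul_primarySum`, Brewer's theorem
  `Brewer1961_characterSum_holds`) these are clauses (i), (iv) of `Deuring_exists_heckeCharacter_of_maximalCM` on the row `j = 8000`.

Nothing about BSD is proved here; no modularity is used.

## References
* A. R. Rajwade, *Arithmetic on curves with complex multiplication by √−2*, Proc. Cambridge Philos. Soc. 64 (1968), Thm. 1. [Rajwade1968]
* A. Silverberg, *Group order formulas for reductions of CM elliptic curves*, Contemp. Math. 521 (2010), Thm. 2.7. [Silverberg2010]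
* J. H. Silverman, *Advanced Topics in the Arithmetic of Elliptic Curves* (1994), II Thm. 9.2, Thm. 10.5, Ex. 2.30–2.32. [SilvermanATAEC1994]
* J. Neukirch, *Algebraic Number Theory* (1999), Ch. VII §6 Def. (6.1), Cor. (6.14). [NeukirchANT1999]

## Mathlib / tree search
Tree: `SqrtNegTwo.{FieldData, gen, span_ringEquiv_gen, ringEquiv_mem_asIdeal_iff, smul_asIdeal_eq, associated_gen_smul, sqrtIdeal_le_iff, modulus_le_iff,
sqrtIdeal_le_iff_two_mem, re_gen_odd, primary_mul_eq_primary_mul_of_dvd_sub, primaryHom}`, `SqrtNegTwoPrimary.{primary, primary_star, primary_of_isUnit,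
primary_eq_primary_of_associated, isPrimary_primary, IsPrimary.ne_zero, norm_primary, primarySum_pow_of_split, primarySum_pow_of_inert,
exists_isPrimary_norm_eq, primary_natCast_of_mod_eight, not_dvd_star_of_norm_eq_prime, natCast_eq_mul_star, norm_emod_two}`,
`GaloisRepresentations.{IsGrossencharakter, embType, prod_embedding_zpow_embType, heckeOfGross*}`, `LFunctions.idealPow`.
Mathlib: `Ideal.finprod_heightOneSpectrum_factorization`, `Zsqrtd.{norm_natCast, norm_mul, norm_conj, norm_eq_one_iff'}`, `Nat.dvd_prime_pow`.
-/

noncomputable section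

open NumberField IsDedekindDomain
open scoped NumberTheorySymbols ComplexConjugate Pointwise

namespace Literature.NumberTheory.QuadraticFields.SqrtNegTwo

open Literature.NumberTheory.QuadraticFields.SqrtNegTwoPrimary
open Literature.NumberTheory.GaloisRepresentations (IsGrossencharakter HeckeCharacter embType embTypeConj prod_embedding_zpow_embType
  heckeOfGross heckeOfGross_hasInfinityType heckeOfGross_isUnramifiedAt heckeOfGross_valueAtUniformizer)
open Literature.NumberTheory.LFunctions (idealPow)

variable {K : Type*} [Field K] [NumberField K] {θ : K}

/-- Associated elements of `ℤ[√−2]` have the same norm (units `±1`). [cite: Rajwade1968, Thm. 1] -/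
theorem norm_eq_of_associated {z w : ℤ√(-2)} (hzw : Associated z w) : z.norm = w.norm := by
  obtain ⟨u, rfl⟩ := hzw
  rw [Zsqrtd.norm_mul, (Zsqrtd.norm_eq_one_iff' (by norm_num) (u : ℤ√(-2))).mpr u.isUnit, mul_one]

section Psi

variable (hK : FieldData θ)
include hK

/-! ### §1 The ideal character `ψ(𝔭) = e(π)`, `π` the primary generator -/

/-- ★ **Rajwade's Größencharakter on the primes of `𝓞 K`**: `ψ(𝔭_v) = e(primary (gen v))` — the PRIMARY generator (`≡ 1, 3, 1 ± √−2,
3 ± √−2, 5 + 2√−2, 7 + 2√−2 (mod 4√−2)`) read in `ℂ`; independent of the generator; `0` at `(√−2)`. [cite: Rajwade1968, Thm. 1] [cite: Silverberg2010, Thm. 2.7] -/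
def psi (e : K →+* ℂ) (v : HeightOneSpectrum (𝓞 K)) : ℂ := hK.toComplex e (primary (gen hK v))

/-- Unfolding `psi`. [cite: Rajwade1968, Thm. 1] -/
theorem psi_apply (e : K →+* ℂ) (v : HeightOneSpectrum (𝓞 K)) : psi hK e v = hK.toComplex e (primary (gen hK v)) := rfl

/-- `ψ(𝔭_v) = e(primary π)` for ANY generator `π` of `𝔭_v`. [cite: Rajwade1968, Thm. 1] -/
theorem psi_eq_of_span_eq (e : K →+* ℂ) {v : HeightOneSpectrum (𝓞 K)} {π : ℤ√(-2)}
    (hπ : Ideal.span {hK.ringEquiv π} = v.asIdeal) : psi hK e v = hK.toComplex e (primary π) := by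
  rw [psi_apply, primary_eq_primary_of_associated (x := gen hK v) (y := π)]
  have h1 := span_ringEquiv_gen hK v
  rw [← hπ, Ideal.span_singleton_eq_span_singleton] at h1
  simpa only [RingEquiv.symm_apply_apply] using h1.map hK.ringEquiv.symm

/-- `ψ(𝔭_v) ≠ 0` off `(√−2)`. [cite: Rajwade1968, Thm. 1] -/
theorem psi_ne_zero (e : K →+* ℂ) {v : HeightOneSpectrum (𝓞 K)} (hv : ¬ hK.sqrtIdeal ≤ v.asIdeal) : psi hK e v ≠ 0 := by
  rw [psi_apply, Ne, hK.toComplex_eq_zero_iff]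
  exact (isPrimary_primary (re_gen_odd hK hv)).ne_zero

/-- `ψ((√−2)) = 0` (junk value at the ramified prime: `re(gen)` even). [cite: Rajwade1968, Thm. 1] -/
theorem psi_eq_zero_of_sqrtIdeal_le (e : K →+* ℂ) {v : HeightOneSpectrum (𝓞 K)} (hv : hK.sqrtIdeal ≤ v.asIdeal) : psi hK e v = 0 := by
  rw [psi_apply, primary_eq_zero_of_even (by have := (sqrtIdeal_le_iff hK v).mp hv; omega), map_zero]

/-- `ψ(c • 𝔭_v) = e((primary (gen v))‾)`. [cite: SilvermanATAEC1994, II Ex. 2.30 (b)] -/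
theorem psi_smul (e : K →+* ℂ) {c : K ≃ₐ[ℚ] K} (hc : c ≠ 1) (v : HeightOneSpectrum (𝓞 K)) :
    psi hK e (c • v) = hK.toComplex e (star (primary (gen hK v))) := by
  rw [← primary_star, psi_eq_of_span_eq hK e (smul_asIdeal_eq hK hc v).symm]

/-- ★ **`ψ(c • 𝔭) = conj ψ(𝔭)` for every prime** (clause (ii) of Deuring's theorem, prime by prime). [cite: SilvermanATAEC1994, II Ex. 2.30 (b) and Cor. 10.4.1 (c)] -/
theorem psi_smul_eq_conj (e : K →+* ℂ) {c : K ≃ₐ[ℚ] K} (hc : c ≠ 1) (v : HeightOneSpectrum (𝓞 K)) :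
    psi hK e (c • v) = conj (psi hK e v) := by
  rw [psi_smul hK e hc, psi_apply, FieldData.toComplex_apply, FieldData.toComplex_apply, ← hK.embedding_algEquiv e hc,
    hK.algEquiv_coe_ringEquiv hc]

/-- ★ **Generic ideal character of generators**: for a monoid homomorphism `T : ℤ[√−2] →* ℂ` trivial on the units and `b ≠ 0` in `𝓞 K`,
`∏_𝔭 T(gen 𝔭)^{ν_𝔭((b))} = T(b)` (unique factorisation in the PID `ℤ[√−2]`). [cite: NeukirchANT1999, Ch. VII §6 Def. (6.1)] -/
theorem idealPow_gen_span (T : ℤ√(-2) →* ℂ) (hT : ∀ u : ℤ√(-2), IsUnit u → T u = 1) {b : 𝓞 K} (hb : b ≠ 0) :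
    idealPow K (fun v => T (gen hK v)) (Ideal.span {b}) = T (hK.ringEquiv.symm b) := by
  classical
  set I : Ideal (𝓞 K) := Ideal.span {b} with hI
  have hI0 : I ≠ ⊥ := by rw [hI, Ne, Ideal.span_singleton_eq_bot]; exact hb
  set cnt : HeightOneSpectrum (𝓞 K) → ℕ := fun v => (Associates.mk v.asIdeal).count (Associates.mk I).factors with hcnt
  have hcnt0 : ∀ v : HeightOneSpectrum (𝓞 K), v ∉ {v : HeightOneSpectrum (𝓞 K) | v.asIdeal ∣ I} → cnt v = 0 := by
    intro v hv
    rw [Set.mem_setOf_eq, ← Associates.count_ne_zero_iff_dvd hI0 v.irreducible] at hv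
    simpa [hcnt] using hv
  have hfin : (Function.mulSupport fun v : HeightOneSpectrum (𝓞 K) => gen hK v ^ cnt v).Finite := by
    refine (Ideal.finite_factors hI0).subset fun v hv => ?_
    rw [Function.mem_mulSupport] at hv
    by_contra hv'
    exact hv (by rw [hcnt0 v hv', pow_zero])
  set G : ℤ√(-2) := ∏ᶠ v : HeightOneSpectrum (𝓞 K), gen hK v ^ cnt v with hG
  let σ : ℤ√(-2) →* Ideal (𝓞 K) :=
    { toFun := fun z => Ideal.span {hK.ringEquiv z}
      map_one' := by rw [map_one, Ideal.span_singleton_one, Ideal.one_eq_top]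
      map_mul' := fun z w => by rw [map_mul, Ideal.span_singleton_mul_span_singleton] }
  have hspan : Ideal.span {hK.ringEquiv G} = I := by
    change σ G = I
    rw [hG, σ.map_finprod hfin, ← Ideal.finprod_heightOneSpectrum_factorization hI0]
    refine finprod_congr fun v => ?_
    rw [map_pow]
    change Ideal.span {hK.ringEquiv (gen hK v)} ^ cnt v = v.maxPowDividing I
    rw [span_ringEquiv_gen hK v]
    rfl
  have hassoc : Associated G (hK.ringEquiv.symm b) := by
    rw [hI, Ideal.span_singleton_eq_span_singleton] at hspan
    simpa only [RingEquiv.symm_apply_apply] using hspan.map hK.ringEquiv.symm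
  have hTG : T G = T (hK.ringEquiv.symm b) := by
    obtain ⟨u, hu⟩ := hassoc
    rw [← hu, map_mul, hT u u.isUnit, mul_one]
  rw [← hTG, hG, T.map_finprod hfin, idealPow]
  exact finprod_congr fun v => by rw [map_pow]

/-- ★ **`ψ̃((b)) = e(primary b)` for every nonzero `b ∈ 𝓞 K`.** [cite: Rajwade1968, Thm. 1] [cite: NeukirchANT1999, Ch. VII §6 Def. (6.1)] -/
theorem idealPow_psi_span (e : K →+* ℂ) {b : 𝓞 K} (hb : b ≠ 0) :
    idealPow K (psi hK e) (Ideal.span {b}) = hK.toComplex e (primary (hK.ringEquiv.symm b)) := by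
  have h := idealPow_gen_span hK ((hK.toComplex e).toMonoidHom.comp primaryHom)
    (fun u hu => by
      change hK.toComplex e (primary u) = 1
      rw [primary_of_isUnit hu, map_one]) hb
  exact h

/-- `ψ̃((n)) = primary(n) = (−1)^{(n−1)(n−3)/8}… read: `ψ̃((n)) = n` for `n ≡ 1, 3 (mod 8)` and `−n` for `n ≡ 5, 7 (mod 8)` — recorded as
`ψ̃((p)) = −p` at the inert primes `p ≡ 5, 7 (mod 8)`. [cite: Rajwade1968, Thm. 1] [cite: Silverberg2010, Thm. 2.7] -/
theorem idealPow_psi_span_natCast_of_mod_eight (e : K →+* ℂ) {p : ℕ} (hp8 : p % 8 = 5 ∨ p % 8 = 7) :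
    idealPow K (psi hK e) (Ideal.span {(p : 𝓞 K)}) = -(p : ℂ) := by
  have hp0 : (p : 𝓞 K) ≠ 0 := by
    have : p ≠ 0 := by omega
    exact_mod_cast this
  rw [idealPow_psi_span hK e hp0, ← hK.ringEquiv_natCast, RingEquiv.symm_apply_apply, primary_natCast_of_mod_eight hp8, map_neg,
    map_natCast]

/-! ### §2 `ψ` is a Größencharakter modulo `(4√−2)` of infinity type `(1, 0)` -/

/-- ★★ **`ψ` is a Größencharakter `mod (4√−2)` of infinity type `(1, 0)` at the place of `e`** (`IsGrossencharakter (4√−2) (embType e)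
(embTypeConj e) ψ`): `ψ(𝔭) ≠ 0` off the modulus, and for nonzero `b ≡ c (mod 4√−2)`, `c` prime to the modulus, `ψ̃((b)) = ψ̃((c)) · e(b/c)`
— since `primary b · c = primary c · b`.  Rajwade 1968 / Silverberg Thm. 2.7 (`χ((α)) = ±α`, `+` iff `α` primary), in Neukirch's sense VII (6.1).
[cite: Rajwade1968, Thm. 1] [cite: NeukirchANT1999, Ch. VII §6 Def. (6.1) and Cor. (6.14)] -/
theorem isGrossencharakter_psi (e : K →+* ℂ) : IsGrossencharakter hK.modulus (embType e) (embTypeConj e) (psi hK e) := by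
  refine ⟨fun v hv => psi_ne_zero hK e (fun h => hv ((modulus_le_iff hK v).mpr h)), fun b c hb hc hcop hbc _ => ?_⟩
  rw [idealPow_psi_span hK e hb, idealPow_psi_span hK e hc, prod_embedding_zpow_embType, map_div₀]
  set b' := hK.ringEquiv.symm b with hb'
  set c' := hK.ringEquiv.symm c with hc'
  have hbK : (b : K) = ((hK.ringEquiv b' : 𝓞 K) : K) := by rw [hb', RingEquiv.apply_symm_apply]
  have hcK : (c : K) = ((hK.ringEquiv c' : 𝓞 K) : K) := by rw [hc', RingEquiv.apply_symm_apply]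
  have hdvd : (4 * Zsqrtd.sqrtd : ℤ√(-2)) ∣ b' - c' := by
    have h1 : b - c ∈ hK.modulus := hbc
    rw [FieldData.modulus, Ideal.mem_span_singleton] at h1
    have h2 := (map_dvd_iff hK.ringEquiv.symm).mpr h1
    rwa [RingEquiv.symm_apply_apply, map_sub] at h2
  have hc0 : e (c : K) ≠ 0 := by rw [map_ne_zero]; exact_mod_cast hc
  rw [mul_div_assoc', eq_div_iff hc0, hbK, hcK, ← FieldData.toComplex_apply, ← FieldData.toComplex_apply, ← map_mul, ← map_mul,
    primary_mul_eq_primary_mul_of_dvd_sub hdvd]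

omit hK in
/-- For `e` the embedding of an infinite place `w₀` (the only one), `embType e ≡ 1`, `embTypeConj e ≡ 0`. [cite: SilvermanATAEC1994, II Thm. 9.2 (a)] -/
private theorem embType_embedding_eq (hK : FieldData θ) (w₀ : InfinitePlace K) :
    embType w₀.embedding = (fun _ : InfinitePlace K => (1 : ℤ)) ∧ embTypeConj w₀.embedding = (fun _ : InfinitePlace K => (0 : ℤ)) := by
  constructor
  · funext w; rw [hK.infinitePlace_eq w w₀, embType, if_pos rfl]
  · funext w; rw [hK.infinitePlace_eq w w₀, embTypeConj, if_pos rfl]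

/-- ★★ **The literal type-`(1, 0)` form**: `IsGrossencharakter (4√−2) (fun _ ↦ 1) (fun _ ↦ 0) ψ` for `e` the embedding of the (unique)
infinite place (the shape of clause (i) of `Deuring_exists_heckeCharacter_of_maximalCM`). [cite: SilvermanATAEC1994, II Thm. 9.2 (a)] [cite: Rajwade1968, Thm. 1] -/
theorem isGrossencharakter_psi_one_zero (w₀ : InfinitePlace K) :
    IsGrossencharakter hK.modulus (fun _ => 1) (fun _ => 0) (psi hK w₀.embedding) := by
  obtain ⟨h1, h2⟩ := embType_embedding_eq hK w₀
  rw [← h1, ← h2]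
  exact isGrossencharakter_psi hK w₀.embedding

/-- **`(4√−2) ∣ 𝔭_v ↔ 2 ∈ 𝔭_v`** (the modulus is supported on the one prime above `2`). [cite: Rajwade1968, Thm. 1] -/
theorem modulus_le_iff_two_mem (v : HeightOneSpectrum (𝓞 K)) : hK.modulus ≤ v.asIdeal ↔ (2 : 𝓞 K) ∈ v.asIdeal := by
  rw [modulus_le_iff hK, sqrtIdeal_le_iff_two_mem hK]

/-! ### §3 Frobenius matching against `S(p) = Σ_{x primary, N x = p} x` -/

/-- **A prime `v ∣ p`, `p ≠ 2`, is prime to `(4√−2)`.** [cite: SilvermanATAEC1994, II Ex. 2.30 (a)] -/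
theorem not_modulus_le_of_natCast_mem {p : ℕ} (hp : p.Prime) (hp2 : p ≠ 2) {v : HeightOneSpectrum (𝓞 K)}
    (hv : (p : 𝓞 K) ∈ v.asIdeal) : ¬ hK.modulus ≤ v.asIdeal := by
  rw [modulus_le_iff_two_mem hK]
  intro h2
  apply v.isPrime.ne_top
  rw [Ideal.eq_top_iff_one]
  have hodd : Odd p := hp.odd_of_ne_two hp2
  obtain ⟨k, hk⟩ := hodd
  have : (1 : 𝓞 K) = (p : 𝓞 K) - 2 * (k : 𝓞 K) := by rw [hk]; push_cast; ring
  rw [this]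
  exact v.asIdeal.sub_mem hv (v.asIdeal.mul_mem_right _ h2)

/-- `N(gen v) = p` or `N(gen v) = p²` for `v ∣ p`. [cite: SilvermanATAEC1994, II Ex. 2.30] -/
theorem norm_gen_eq_or {p : ℕ} (hp : p.Prime) {v : HeightOneSpectrum (𝓞 K)} (hv : (p : 𝓞 K) ∈ v.asIdeal) :
    (gen hK v).norm = p ∨ (gen hK v).norm = (p : ℤ) ^ 2 := by
  rw [← hK.ringEquiv_natCast, ringEquiv_mem_asIdeal_iff hK] at hv
  have hN := norm_dvd_norm hv
  rw [Zsqrtd.norm_natCast] at hN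
  have h0 := norm_nonneg' (gen hK v)
  have h1 : ((gen hK v).norm).natAbs ∣ p ^ 2 := by
    have := Int.natAbs_dvd_natAbs.mpr hN; simpa [Int.natAbs_mul, sq] using this
  obtain ⟨i, hi, hi'⟩ := (Nat.dvd_prime_pow hp).mp h1
  interval_cases i
  · exact absurd (by rw [← Int.natAbs_of_nonneg h0, hi', pow_zero, Nat.cast_one]) (norm_gen_ne_one hK v)
  · left; rw [← Int.natAbs_of_nonneg h0, hi', pow_one]
  · right; rw [← Int.natAbs_of_nonneg h0, hi']; push_cast; ring

/-- **Inert case**: `N(gen v) = p²` forces `gen v ~ p`, `p ≡ 5, 7 (mod 8)`, `c • v = v`, `S(p) = 0`, `ψ(v) = −p`.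
[cite: SilvermanATAEC1994, II Ex. 2.30 (c)] [cite: Rajwade1968, Thm. 1] -/
theorem inert_of_norm_gen_eq_sq (e : K →+* ℂ) {c : K ≃ₐ[ℚ] K} (hc : c ≠ 1) {p : ℕ} (hp : p.Prime) (hp2 : p ≠ 2)
    {v : HeightOneSpectrum (𝓞 K)} (hv : (p : 𝓞 K) ∈ v.asIdeal) (hN : (gen hK v).norm = (p : ℤ) ^ 2) :
    (p % 8 = 5 ∨ p % 8 = 7) ∧ c • v = v ∧ primarySum p = 0 ∧ psi hK e v = -(p : ℂ) := by
  haveI := Fact.mk hp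
  have hv' : gen hK v ∣ (p : ℤ√(-2)) := by
    rw [← hK.ringEquiv_natCast, ringEquiv_mem_asIdeal_iff hK] at hv; exact hv
  have hassoc : Associated (gen hK v) (p : ℤ√(-2)) := by
    obtain ⟨u, hu⟩ := hv'
    have hnu : u.norm = 1 := by
      have h := congrArg Zsqrtd.norm hu
      rw [Zsqrtd.norm_natCast, Zsqrtd.norm_mul, hN, sq] at h
      have hp0 : ((p : ℤ) * p) ≠ 0 := mul_ne_zero (by exact_mod_cast hp.ne_zero) (by exact_mod_cast hp.ne_zero)
      exact (mul_right_inj' hp0).mp (by rw [← h, mul_one])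
    exact ⟨((Zsqrtd.norm_eq_one_iff' (by norm_num) u).mp hnu).unit, by rw [IsUnit.unit_spec]; exact hu.symm⟩
  have hspan : v.asIdeal = Ideal.span {(p : 𝓞 K)} := by
    rw [← span_ringEquiv_gen hK v, ← hK.ringEquiv_natCast, Ideal.span_singleton_eq_span_singleton]
    exact hassoc.map hK.ringEquiv
  -- `p ≡ 5, 7 (mod 8)`: otherwise `p = π π̄` with `N π = p`
  have hp8 : p % 8 = 5 ∨ p % 8 = 7 := by
    have hodd : p % 2 = 1 := Nat.odd_iff.mp (hp.odd_of_ne_two hp2)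
    by_contra h57
    have h13 : p % 8 = 1 ∨ p % 8 = 3 := by omega
    obtain ⟨π, -, hπ⟩ := exists_isPrimary_norm_eq h13
    have hmem : hK.ringEquiv π * hK.ringEquiv (star π) ∈ v.asIdeal := by
      rw [← map_mul, ← natCast_eq_mul_star hπ, hK.ringEquiv_natCast]; exact hv
    have hp2' : ¬ (p : ℤ) ^ 2 ∣ (p : ℤ) := by
      intro h
      have := Int.le_of_dvd (by exact_mod_cast hp.pos) h
      have h2 : (2 : ℤ) ≤ p := by exact_mod_cast hp.two_le
      nlinarith
    rcases v.isPrime.mem_or_mem hmem with h | h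
    · rw [ringEquiv_mem_asIdeal_iff hK] at h
      have := norm_dvd_norm h; rw [hN, hπ] at this; exact hp2' this
    · rw [ringEquiv_mem_asIdeal_iff hK] at h
      have := norm_dvd_norm h; rw [hN, Zsqrtd.norm_conj, hπ] at this; exact hp2' this
  have hS : primarySum p = 0 := by
    have h0 := (primarySum_pow_of_inert hp8 0).2
    rwa [mul_zero, zero_add, pow_one] at h0
  refine ⟨hp8, ?_, hS, ?_⟩
  · apply HeightOneSpectrum.ext
    rw [smul_asIdeal_eq hK hc v, hspan, ← hK.ringEquiv_natCast, Ideal.span_singleton_eq_span_singleton]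
    have h2 : Associated (star (gen hK v)) (p : ℤ√(-2)) := by
      have h3 := hassoc.map (starRingEnd (ℤ√(-2)))
      rwa [starRingEnd_apply, starRingEnd_apply, star_natCast] at h3
    exact h2.map hK.ringEquiv
  · rw [psi_apply, primary_eq_primary_of_associated hassoc, primary_natCast_of_mod_eight hp8, map_neg, map_natCast]

/-- **Split case**: `N(gen v) = p` (so `p` odd off `(√−2)`), `π = primary (gen v)`: `c • v ≠ v`, `ψ(v) + ψ(c • v) = e(S(p))`, `ψ(v) ψ(c • v) = p`.
[cite: SilvermanATAEC1994, II Ex. 2.30 (b)] [cite: Rajwade1968, Thm. 1] -/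
theorem split_of_norm_gen_eq (e : K →+* ℂ) {c : K ≃ₐ[ℚ] K} (hc : c ≠ 1) {p : ℕ} (hp : p.Prime) (hp2 : p ≠ 2)
    {v : HeightOneSpectrum (𝓞 K)} (hN : (gen hK v).norm = p) :
    c • v ≠ v ∧ psi hK e v + psi hK e (c • v) = hK.toComplex e (primarySum p) ∧ psi hK e v * psi hK e (c • v) = p := by
  have hodd : (gen hK v).re % 2 = 1 := by
    rw [← norm_emod_two, hN]
    exact_mod_cast Nat.odd_iff.mp (hp.odd_of_ne_two hp2)
  set π := primary (gen hK v) with hπ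
  have hπp : IsPrimary π := isPrimary_primary hodd
  have hπN : π.norm = p := by rw [hπ, norm_primary hodd, hN]
  refine ⟨fun heq => ?_, ?_, ?_⟩
  · have h1 := associated_gen_smul hK hc v
    rw [heq] at h1
    exact not_dvd_star_of_norm_eq_prime hp hp2 hN h1.dvd
  · have hS := primarySum_pow_of_split hp hp2 hπp hπN 1
    simp only [pow_one, Finset.sum_range_succ, Finset.sum_range_zero, pow_zero, one_mul, mul_one, Nat.sub_zero,
      Nat.sub_self, zero_add] at hS
    have hS' : primarySum p = π + star π := by linear_combination hS
    rw [psi_smul hK e hc, psi_apply, ← map_add, hS']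
  · rw [psi_smul hK e hc, psi_apply, ← map_mul, ← cast_norm_eq, hπN, Int.cast_natCast, map_natCast]

/-- ★★ **Frobenius matching** (Rajwade's Theorem 1 on the character side; Silverman II Ex. 2.30 (b), (c)): for a prime `p ≠ 2` and `v ∣ p`:
`c • v ≠ v → ψ(v) + ψ(c • v) = e(S(p)) ∧ ψ(v) ψ(c • v) = p`; `c • v = v → S(p) = 0 ∧ ψ(v) = −p`. [cite: Rajwade1968, Thm. 1] [cite: SilvermanATAEC1994, II Ex. 2.30 (b), (c)] -/
theorem frobenius (e : K →+* ℂ) {c : K ≃ₐ[ℚ] K} (hc : c ≠ 1) {p : ℕ} (hp : p.Prime) (hp2 : p ≠ 2)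
    {v : HeightOneSpectrum (𝓞 K)} (hv : (p : 𝓞 K) ∈ v.asIdeal) :
    (c • v ≠ v → psi hK e v + psi hK e (c • v) = hK.toComplex e (primarySum p) ∧ psi hK e v * psi hK e (c • v) = p) ∧
    (c • v = v → primarySum p = 0 ∧ psi hK e v = -(p : ℂ)) := by
  rcases norm_gen_eq_or hK hp hv with hN | hN
  · obtain ⟨hne, hsum, hprod⟩ := split_of_norm_gen_eq hK e hc hp hp2 hN
    exact ⟨fun _ => ⟨hsum, hprod⟩, fun heq => absurd heq hne⟩
  · obtain ⟨-, heq, hS, hψ⟩ := inert_of_norm_gen_eq_sq hK e hc hp hp2 hv hN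
    exact ⟨fun hne => absurd heq hne, fun _ => ⟨hS, hψ⟩⟩

/-- ★★ **Frobenius matching against an integer `a_p` with `a_p = S(p)` in `ℤ[√−2]`**: split `ψ(v) + ψ(c • v) = a_p`, `ψ(v) ψ(c • v) = p`;
inert `a_p = 0`, `ψ(v) = −p` — clause (iv) of `Deuring_exists_heckeCharacter_of_maximalCM` for `ψ = heckeOfGross` of §2's datum.
[cite: SilvermanATAEC1994, II Thm. 10.5 (b), Ex. 2.30 (b), (c)] [cite: Rajwade1968, Thm. 1] -/
theorem frobenius_of_eq_primarySum (e : K →+* ℂ) {c : K ≃ₐ[ℚ] K} (hc : c ≠ 1) {p : ℕ} (hp : p.Prime) (hp2 : p ≠ 2)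
    {t : ℤ} (ht : ((t : ℤ) : ℤ√(-2)) = primarySum p) {v : HeightOneSpectrum (𝓞 K)} (hv : (p : 𝓞 K) ∈ v.asIdeal) :
    (c • v ≠ v → psi hK e v + psi hK e (c • v) = (t : ℂ) ∧ psi hK e v * psi hK e (c • v) = p) ∧
    (c • v = v → t = 0 ∧ psi hK e v = -(p : ℂ)) := by
  obtain ⟨hsplit, hinert⟩ := frobenius hK e hc hp hp2 hv
  refine ⟨fun hne => ?_, fun heq => ?_⟩
  · obtain ⟨hsum, hprod⟩ := hsplit hne
    exact ⟨by rw [hsum, ← ht, map_intCast], hprod⟩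
  · obtain ⟨hS, hψ⟩ := hinert heq
    refine ⟨?_, hψ⟩
    rw [hS] at ht
    exact_mod_cast (Int.cast_injective (α := ℤ√(-2))) (by rw [ht, Int.cast_zero])

omit hK in
/-- `p ∈ 𝔭_{c • v} ↔ p ∈ 𝔭_v`. [cite: SilvermanATAEC1994, II Ex. 2.30] -/
private theorem natCast_mem_smul_asIdeal_iff (c : K ≃ₐ[ℚ] K) (v : HeightOneSpectrum (𝓞 K)) (p : ℕ) :
    (p : 𝓞 K) ∈ (c • v).asIdeal ↔ (p : 𝓞 K) ∈ v.asIdeal := by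
  have h : c • (p : 𝓞 K) = p := by
    apply RingOfIntegers.ext
    rw [Literature.NumberTheory.Automorphic.RingOfIntegers.coe_algEquiv_smul]
    push_cast
    exact map_natCast c p
  conv_lhs => rw [← h]
  exact Literature.NumberTheory.Automorphic.HeightOneSpectrum.smul_mem_smul_asIdeal_iff c v (p : 𝓞 K)

/-- ★★ **The Größencharakter datum of `ℚ(√−2)` packaged in the shape of Deuring's theorem**: for `c ≠ 1`, an infinite place `w₀` and `f` with
`f p = S(p)` in `ℤ[√−2]` at the odd primes: `𝔣 = (4√−2) ≠ 0` with `𝔣 ∣ 𝔭_v ↔ 2 ∈ 𝔭_v`, `ψ₀ = psi` with `IsGrossencharakter 𝔣 (1,0) ψ₀`,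
`ψ₀(c • v) = conj ψ₀(v)`, `ψ̃₀((p)) = −p` for `p ≡ 5, 7 (mod 8)`, and at every `v ∣ p`, `p` odd: `𝔣 ∤ 𝔭_v` and Deuring's split/inert values.
[cite: SilvermanATAEC1994, II Thm. 9.2 and Ex. 2.30 (b), (c)] [cite: Rajwade1968, Thm. 1] -/
theorem exists_isGrossencharakter_datum {c : K ≃ₐ[ℚ] K} (hc : c ≠ 1) (w₀ : InfinitePlace K) (f : ℕ → ℤ)
    (hf : ∀ p : ℕ, p.Prime → p ≠ 2 → ((f p : ℤ) : ℤ√(-2)) = primarySum p) :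
    ∃ (𝔣 : Ideal (𝓞 K)) (ψ₀ : HeightOneSpectrum (𝓞 K) → ℂ), 𝔣 ≠ ⊥ ∧
      (∀ v : HeightOneSpectrum (𝓞 K), 𝔣 ≤ v.asIdeal ↔ (2 : 𝓞 K) ∈ v.asIdeal) ∧
      IsGrossencharakter 𝔣 (fun _ => 1) (fun _ => 0) ψ₀ ∧
      (∀ v : HeightOneSpectrum (𝓞 K), ψ₀ (c • v) = conj (ψ₀ v)) ∧
      (∀ p : ℕ, (p % 8 = 5 ∨ p % 8 = 7) → idealPow K ψ₀ (Ideal.span {(p : 𝓞 K)}) = -(p : ℂ)) ∧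
      ∀ (p : ℕ), p.Prime → p ≠ 2 → ∀ v : HeightOneSpectrum (𝓞 K), (p : 𝓞 K) ∈ v.asIdeal →
        ¬ 𝔣 ≤ v.asIdeal ∧
        (c • v ≠ v → ψ₀ v + ψ₀ (c • v) = (f p : ℂ) ∧ ψ₀ v * ψ₀ (c • v) = p) ∧
        (c • v = v → f p = 0 ∧ ψ₀ v = -(p : ℂ)) :=
  ⟨hK.modulus, psi hK w₀.embedding, hK.modulus_ne_bot, modulus_le_iff_two_mem hK, isGrossencharakter_psi_one_zero hK w₀,
    psi_smul_eq_conj hK w₀.embedding hc, fun _ hp8 => idealPow_psi_span_natCast_of_mod_eight hK w₀.embedding hp8,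
    fun _ hp hp2 _ hv => ⟨not_modulus_le_of_natCast_mem hK hp hp2 hv, frobenius_of_eq_primarySum hK w₀.embedding hc hp hp2 (hf _ hp hp2) hv⟩⟩

/-- ★★ **The algebraic Hecke character of `ℚ(√−2)` with Frobenius values `a_p = S(p)`** (clauses (i), (iv) and the prime-level (ii) of Deuring's
theorem for a curve with `a_p = S(p)` at the odd primes — `B₋₁ : y² = x³ − 4x² + 2x`; `ψ = heckeOfGross` of the datum, Neukirch VII (6.14)).
[cite: SilvermanATAEC1994, II Thm. 9.2 (a), Thm. 10.5 (b), Ex. 2.30 (b), (c)] [cite: NeukirchANT1999, Ch. VII §6 Cor. (6.14)] -/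
theorem exists_heckeCharacter_of_eq_primarySum {c : K ≃ₐ[ℚ] K} (hc : c ≠ 1) (w₀ : InfinitePlace K) (f : ℕ → ℤ)
    (hf : ∀ p : ℕ, p.Prime → p ≠ 2 → ((f p : ℤ) : ℤ√(-2)) = primarySum p) :
    ∃ ψ : HeckeCharacter K, ψ.HasInfinityType (fun _ => 1) (fun _ => 0) ∧
      ∀ (p : ℕ), p.Prime → p ≠ 2 → ∀ v : HeightOneSpectrum (𝓞 K), (p : 𝓞 K) ∈ v.asIdeal →
        ψ.IsUnramifiedAt v ∧ ψ.valueAtUniformizer (c • v) = conj (ψ.valueAtUniformizer v) ∧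
        (c • v ≠ v → ψ.valueAtUniformizer v + ψ.valueAtUniformizer (c • v) = (f p : ℂ) ∧
          ψ.valueAtUniformizer v * ψ.valueAtUniformizer (c • v) = p) ∧
        (c • v = v → f p = 0 ∧ ψ.valueAtUniformizer v = -(p : ℂ)) := by
  have h𝔣 := hK.modulus_ne_bot
  have hψ := isGrossencharakter_psi_one_zero hK w₀
  refine ⟨heckeOfGross h𝔣 hψ, heckeOfGross_hasInfinityType h𝔣 hψ, fun p hp hp2 v hv => ?_⟩
  have hv' : ¬ hK.modulus ≤ v.asIdeal := not_modulus_le_of_natCast_mem hK hp hp2 hv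
  have hcv : (p : 𝓞 K) ∈ (c • v).asIdeal := (natCast_mem_smul_asIdeal_iff c v p).mpr hv
  have hcv' : ¬ hK.modulus ≤ (c • v).asIdeal := not_modulus_le_of_natCast_mem hK hp hp2 hcv
  rw [heckeOfGross_valueAtUniformizer h𝔣 hψ hv', heckeOfGross_valueAtUniformizer h𝔣 hψ hcv']
  exact ⟨heckeOfGross_isUnramifiedAt h𝔣 hψ hv', psi_smul_eq_conj hK w₀.embedding hc v,
    frobenius_of_eq_primarySum hK w₀.embedding hc hp hp2 (hf p hp hp2) hv⟩

end Psi

end Literature.NumberTheory.QuadraticFields.SqrtNegTwo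

end
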